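import Summits.KontsevichZagierPeriods.KontsevichZagierPeriods.Theorems.RootDecompRelativeModAbsoluteRegKernelPairLeOneP01

/-!
(LANDED by the census seat decomp-kz-census-1 g7 `--supports stmt-KontsevichZagierPeriods-30572`; source lens-3 g9 landing package, critic decomp-kz-crit-1 g2 CLEARED §14 2026-08-30T09:58:21Z; generic docstrings added where the source had none.)

# `RegKernelPairDegOne` for `k + k' ≤ 1` (route `RootDecompRelativeModAbsolute`, first transcendence rung of
support item stmt-KontsevichZagierPeriods-30572) — PROVED · part 2/3

Cell `decomp-kz`, lens 3 (decomp-kz-lens-3 g9).  `regKernelPairDegOne_of_add_le_one` (part 3/3) is the text of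
the route item `RegKernelPairDegOne` VERBATIM under the extra hypothesis `k + k' ≤ 1`: ONE unfolded regularised
log/arctan monomial `[g.domain × (0,1), h(x) θ^M/(1+θ^e κ(x))]` (`e ∈ {1,2}`, any Taylor order `M`) against none —
if the folded fibre functions agree a.e. then the unfoldings are congruent modulo `KZ.relations`.
Part 1: scalar corollaries of Baker's theorem (`baker_holds`, incl. the unit-circle case for `arctan`) and the
analysis of the kernels `θ^M/(1+θ^e κ)` (positivity, bounds, continuity of `ℓ_{M,e}` on `(-1,∞)` by dominated
convergence).  Part 2: `ℓ_{M,e}(0) = 1/(M+1)`, the recursion `κ ℓ_{M+e,e} = 1/(M+1) − ℓ_{M,e}`, the closed forms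
`ℓ_{0,1} = log(1+κ)/κ`, `ℓ_{1,2} = log(1+κ)/(2κ)`, `ℓ_{0,2} = arctan √κ/√κ` resp. `(log(1+u) − log(1−u))/(2u)`
(`u = √(−κ)`) by FTC, and `transcendental_ell`: `ℓ_{M,e}(κ)` is transcendental at algebraic `κ ∈ (−1,∞)∖{0}`.
Part 3: the rigidity lemma `mul_kappa_ae_eq_zero` (`1_G (g₀ + h ℓ_{M,e}(κ)) = 1_{G'} g₀'` a.e. with
`ℚ`-semialgebraic data forces `h κ = 0` a.e. — smooth full-measure loci, continuity, values at the dense algebraic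
points), the KZ assembly `single_monomial`, and the rung theorem.

Source: `HOME/decomp-kz-lens-3/g9/RelativeModAbsoluteDegOneBands.lean` §14 (sha256 2ea10d4a6cc47b20, 5603 l; farm
rc 0 / 0 warn / 0 sorry; `#print axioms regKernelPairDegOne_of_add_le_one` = propext, Classical.choice, Quot.sound),
extracted verbatim into the namespace of the landed `RegFoldingDegOne` chain (toolkit §0–§13 =
`RootDecompRelativeModAbsoluteRegFoldingDegOneP01…P14`).  No `sorry`; standard axioms.
References: Baker 1975 (Transcendental Number Theory) Thm 2.1 [tree: `baker_holds`]; [cite: KontsevichZagier2001, §1.2];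
Bochnak–Coste–Roy 1998 §2.9.
-/

noncomputable section

open Set MeasureTheory Filter Topology
open scoped BigOperators
open Literature.NumberTheory.Transcendental Literature.ModelTheory.ExponentialFields

namespace Summit.KontsevichZagierPeriods.RootDecompRelativeModAbsolute.Rung30571

namespace RegularisedLogLayer

-- PRIVATE copies (the landed twins of these CircleBaker lemmas live in farm-unbuilt modules; part 1 keeps them private): 
namespace CircleBaker

/-- `isAlgebraic_ofReal`: auxiliary theorem of the first transcendence rung `k + k′ ≤ 1` of `RegKernelPairDegOne` (stmt-30572), lens-3 g9 §14 — see the module docstring; verbatim from the lens file. -/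
private theorem isAlgebraic_ofReal {x : ℝ} (hx : IsAlgebraic ℚ x) : IsAlgebraic ℚ (x : ℂ) :=
  (isAlgebraic_algebraMap_iff (A := ℂ) Complex.ofReal_injective).mpr hx

/-- `exp (log w) = w` is algebraic for a positive real algebraic `w`. [folklore] -/
private theorem isAlgebraic_cexp_log {w : ℝ} (hw : IsAlgebraic ℚ w) (hpos : 0 < w) :
    IsAlgebraic ℚ (Complex.exp ((Real.log w : ℝ) : ℂ)) := by
  rw [← Complex.ofReal_exp, Real.exp_log hpos]
  exact isAlgebraic_ofReal hw

/-- **`log w` is transcendental** for real algebraic `w > 0`, `w ≠ 1` — in the form: an algebraic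
`log w` vanishes. [Baker1975 Thm 2.1 with n = 1 (Lindemann); folklore] -/
private theorem log_eq_zero_of_isAlgebraic {w : ℝ} (hw : 0 < w) (hwalg : IsAlgebraic ℚ w)
    (hlog : IsAlgebraic ℚ (Real.log w)) : Real.log w = 0 := by
  have h := (baker_complex (ι := Fin 1) (fun _ => ((Real.log w : ℝ) : ℂ)) (fun _ => 1)
    ((Real.log w : ℝ) : ℂ) (fun _ => isAlgebraic_cexp_log hwalg hw) (fun _ => isAlgebraic_one)
    (isAlgebraic_ofReal hlog) (by simp)).1
  exact_mod_cast h

end CircleBaker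

/-! ### Values: `ℓ_{M,e}(0)`, the recursion in `M`, closed forms of the base cases -/

/-- `integral_pow_Ioo`: auxiliary theorem of the first transcendence rung `k + k′ ≤ 1` of `RegKernelPairDegOne` (stmt-30572), lens-3 g9 §14 — see the module docstring; verbatim from the lens file. -/
theorem integral_pow_Ioo (M : ℕ) : ∫ θ in Ioo (0 : ℝ) 1, θ ^ M = 1 / (M + 1) := by
  rw [← integral_Ioc_eq_integral_Ioo, ← intervalIntegral.integral_of_le zero_le_one, integral_pow]
  simp

/-- `ell_at_zero`: auxiliary theorem of the first transcendence rung `k + k′ ≤ 1` of `RegKernelPairDegOne` (stmt-30572), lens-3 g9 §14 — see the module docstring; verbatim from the lens file. -/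
theorem ell_at_zero (M e : ℕ) : ell M e 0 = 1 / (M + 1) := by
  have h : EqOn (kernel M e 0) (fun θ => θ ^ M) (Ioo (0 : ℝ) 1) := fun θ _ => by simp [kernel]
  rw [ell, setIntegral_congr_fun measurableSet_Ioo h, integral_pow_Ioo]

/-- `ell_add`: auxiliary theorem of the first transcendence rung `k + k′ ≤ 1` of `RegKernelPairDegOne` (stmt-30572), lens-3 g9 §14 — see the module docstring; verbatim from the lens file. -/
theorem ell_add (M e : ℕ) {κ : ℝ} (hκ : -1 < κ) (hκ0 : κ ≠ 0) :
    ell (M + e) e κ = (1 / (M + 1) - ell M e κ) / κ := by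
  have hpt : EqOn (kernel (M + e) e κ) (fun θ => (θ ^ M - kernel M e κ θ) / κ) (Ioo (0 : ℝ) 1) := by
    intro θ hθ
    have hd := (one_add_pow_mul_pos e hκ (Ioo_subset_Icc_self hθ)).ne'
    simp only [kernel, pow_add]
    field_simp
    ring
  have hpi : IntegrableOn (fun θ : ℝ => θ ^ M) (Ioo (0 : ℝ) 1) :=
    ((continuous_pow M).integrableOn_Icc (μ := volume)).mono_set Ioo_subset_Icc_self
  rw [ell, setIntegral_congr_fun measurableSet_Ioo hpt, integral_div,
    integral_sub hpi (integrableOn_kernel M e hκ), integral_pow_Ioo]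
  rfl

/-- `isAlgebraic_one_div_natCast_add_one`: auxiliary theorem of the first transcendence rung `k + k′ ≤ 1` of `RegKernelPairDegOne` (stmt-30572), lens-3 g9 §14 — see the module docstring; verbatim from the lens file. -/
theorem isAlgebraic_one_div_natCast_add_one (n : ℕ) : IsAlgebraic ℚ (1 / ((n : ℝ) + 1)) := by
  rw [one_div]
  exact ((isAlgebraic_nat n).add isAlgebraic_one).inv

/-- `ℓ_{qe+r,e}(κ) = a + b ℓ_{r,e}(κ)` with `a, b ∈ ℚ(κ)`, `b ≠ 0`. [folklore] -/
theorem ell_affine {κ : ℝ} (hκ : -1 < κ) (hκ0 : κ ≠ 0) (hκa : IsAlgebraic ℚ κ) (e r : ℕ) :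
    ∀ q : ℕ, ∃ a b : ℝ, IsAlgebraic ℚ a ∧ IsAlgebraic ℚ b ∧ b ≠ 0 ∧
      ell (q * e + r) e κ = a + b * ell r e κ := by
  intro q
  induction q with
  | zero => exact ⟨0, 1, isAlgebraic_zero, isAlgebraic_one, one_ne_zero, by simp⟩
  | succ q ih =>
    obtain ⟨a, b, ha, hb, hb0, hq⟩ := ih
    have hM : (q + 1) * e + r = (q * e + r) + e := by ring
    refine ⟨(1 / (((q * e + r : ℕ) : ℝ) + 1) - a) * κ⁻¹, -b * κ⁻¹,
      ((isAlgebraic_one_div_natCast_add_one _).sub ha).mul hκa.inv, (hb.neg).mul hκa.inv,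
      mul_ne_zero (neg_ne_zero.2 hb0) (inv_ne_zero hκ0), ?_⟩
    rw [hM, ell_add _ _ hκ hκ0, hq]
    ring

/-- `ell_affine_mod`: auxiliary theorem of the first transcendence rung `k + k′ ≤ 1` of `RegKernelPairDegOne` (stmt-30572), lens-3 g9 §14 — see the module docstring; verbatim from the lens file. -/
theorem ell_affine_mod {κ : ℝ} (hκ : -1 < κ) (hκ0 : κ ≠ 0) (hκa : IsAlgebraic ℚ κ) (M e : ℕ) :
    ∃ a b : ℝ, IsAlgebraic ℚ a ∧ IsAlgebraic ℚ b ∧ b ≠ 0 ∧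
      ell M e κ = a + b * ell (M % e) e κ := by
  obtain ⟨a, b, ha, hb, hb0, h⟩ := ell_affine hκ hκ0 hκa e (M % e) (M / e)
  rw [Nat.div_add_mod'] at h
  exact ⟨a, b, ha, hb, hb0, h⟩

/-- `ℓ_{0,1}(κ) = log(1+κ)/κ`. -/
theorem ell_zero_one {κ : ℝ} (hκ : -1 < κ) (hκ0 : κ ≠ 0) : ell 0 1 κ = Real.log (1 + κ) / κ := by
  have e1 : EqOn (kernel 0 1 κ) (fun θ => 1 / (κ * θ + 1)) (Ioo (0 : ℝ) 1) := fun θ _ => by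
    simp only [kernel, pow_zero, pow_one]; ring
  rw [ell, setIntegral_congr_fun measurableSet_Ioo e1, ← integral_Ioc_eq_integral_Ioo,
    ← intervalIntegral.integral_of_le zero_le_one]
  have h := intervalIntegral.integral_comp_mul_add (a := (0 : ℝ)) (b := 1)
    (f := fun x : ℝ => 1 / x) hκ0 1
  simp only [mul_zero, zero_add, mul_one, smul_eq_mul] at h
  rw [h, integral_one_div_of_pos one_pos (by linarith), div_one, div_eq_inv_mul, add_comm]

/-- `ℓ_{1,2}(κ) = log(1+κ)/(2κ)`. -/
theorem ell_one_two {κ : ℝ} (hκ : -1 < κ) (hκ0 : κ ≠ 0) :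
    ell 1 2 κ = Real.log (1 + κ) / (2 * κ) := by
  have e1 : EqOn (kernel 1 2 κ) (fun t => t / (1 + κ * t ^ 2)) (Ioo (0 : ℝ) 1) := fun t _ => by
    simp only [kernel, pow_one]; ring
  rw [ell, setIntegral_congr_fun measurableSet_Ioo e1, ← integral_Ioc_eq_integral_Ioo,
    ← intervalIntegral.integral_of_le zero_le_one]
  have hden : ∀ t ∈ uIcc (0 : ℝ) 1, 0 < 1 + κ * t ^ 2 := by
    intro t ht
    rw [uIcc_of_le zero_le_one] at ht
    have := one_add_pow_mul_pos 2 hκ ht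
    linarith [mul_comm κ (t ^ 2)]
  have hderiv : ∀ t ∈ uIcc (0 : ℝ) 1,
      HasDerivAt (fun t => Real.log (1 + κ * t ^ 2) / (2 * κ)) (t / (1 + κ * t ^ 2)) t := by
    intro t ht
    have h0 := hden t ht
    have h1 : HasDerivAt (fun t => 1 + κ * t ^ 2) (κ * (2 * t)) t := by
      have := ((hasDerivAt_pow 2 t).const_mul κ).const_add 1
      simpa using this
    have h2 : HasDerivAt (fun t => Real.log (1 + κ * t ^ 2)) (κ * (2 * t) / (1 + κ * t ^ 2)) t :=
      h1.log h0.ne'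
    refine (h2.div_const (2 * κ)).congr_deriv ?_
    have h0' : 1 + κ * t ^ 2 ≠ 0 := h0.ne'
    rw [div_div, div_eq_div_iff (mul_ne_zero h0' (mul_ne_zero two_ne_zero hκ0)) h0']
    ring
  have hint : IntervalIntegrable (fun t => t / (1 + κ * t ^ 2)) volume 0 1 := by
    refine ContinuousOn.intervalIntegrable ?_
    exact continuousOn_id.div (by fun_prop) fun t ht => (hden t ht).ne'
  rw [intervalIntegral.integral_eq_sub_of_hasDerivAt hderiv hint]
  simp

/-- `ℓ_{0,2}(κ) = arctan(√κ)/√κ` for `κ > 0`. -/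
theorem ell_zero_two_pos {κ : ℝ} (hκ : 0 < κ) :
    ell 0 2 κ = Real.arctan (Real.sqrt κ) / Real.sqrt κ := by
  set u := Real.sqrt κ with hu
  have hu0 : 0 < u := Real.sqrt_pos.2 hκ
  have hu2 : u ^ 2 = κ := Real.sq_sqrt hκ.le
  have e1 : EqOn (kernel 0 2 κ) (fun t => 1 / (1 + (u * t) ^ 2)) (Ioo (0 : ℝ) 1) := fun t _ => by
    simp only [kernel, pow_zero]; rw [← hu2]; ring
  rw [ell, setIntegral_congr_fun measurableSet_Ioo e1, ← integral_Ioc_eq_integral_Ioo,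
    ← intervalIntegral.integral_of_le zero_le_one]
  have hden : ∀ t : ℝ, 0 < 1 + (u * t) ^ 2 := fun t => by positivity
  have hderiv : ∀ t ∈ uIcc (0 : ℝ) 1,
      HasDerivAt (fun t => Real.arctan (u * t) / u) (1 / (1 + (u * t) ^ 2)) t := by
    intro t _
    have h1 : HasDerivAt (fun t => u * t) u t := by simpa using (hasDerivAt_id t).const_mul u
    have h2 : HasDerivAt (fun t => Real.arctan (u * t)) (1 / (1 + (u * t) ^ 2) * u) t :=
      (Real.hasDerivAt_arctan (u * t)).comp t h1
    refine (h2.div_const u).congr_deriv ?_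
    field_simp
  have hint : IntervalIntegrable (fun t => 1 / (1 + (u * t) ^ 2)) volume 0 1 := by
    refine ContinuousOn.intervalIntegrable ?_
    exact continuousOn_const.div (by fun_prop) fun t _ => (hden t).ne'
  rw [intervalIntegral.integral_eq_sub_of_hasDerivAt hderiv hint]
  simp

/-- `ℓ_{0,2}(κ) = (log(1+u) − log(1−u))/(2u)`, `u = √(−κ)`, for `−1 < κ < 0`. -/
theorem ell_zero_two_neg {κ : ℝ} (hκ : -1 < κ) (hκn : κ < 0) :
    ell 0 2 κ = (Real.log (1 + Real.sqrt (-κ)) - Real.log (1 - Real.sqrt (-κ))) /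
      (2 * Real.sqrt (-κ)) := by
  set u := Real.sqrt (-κ) with hu
  have hu0 : 0 < u := Real.sqrt_pos.2 (by linarith)
  have hu2 : u ^ 2 = -κ := Real.sq_sqrt (by linarith)
  have hu1 : u < 1 := by
    rw [hu, show (1 : ℝ) = Real.sqrt 1 by simp]
    exact Real.sqrt_lt_sqrt (by linarith) (by linarith)
  have e1 : EqOn (kernel 0 2 κ) (fun t => 1 / (1 - (u * t) ^ 2)) (Ioo (0 : ℝ) 1) := fun t _ => by
    simp only [kernel, pow_zero]; rw [mul_pow, hu2]; ring
  rw [ell, setIntegral_congr_fun measurableSet_Ioo e1, ← integral_Ioc_eq_integral_Ioo,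
    ← intervalIntegral.integral_of_le zero_le_one]
  have hp : ∀ t ∈ uIcc (0 : ℝ) 1, 0 < 1 + u * t ∧ 0 < 1 - u * t := by
    intro t ht
    rw [uIcc_of_le zero_le_one] at ht
    have h1 : 0 ≤ u * t := mul_nonneg hu0.le ht.1
    have h2 : u * t ≤ u := by nlinarith [ht.2]
    constructor <;> linarith
  have hderiv : ∀ t ∈ uIcc (0 : ℝ) 1,
      HasDerivAt (fun t => (Real.log (1 + u * t) - Real.log (1 - u * t)) / (2 * u))
        (1 / (1 - (u * t) ^ 2)) t := by
    intro t ht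
    obtain ⟨h1, h2⟩ := hp t ht
    have d1 : HasDerivAt (fun t => 1 + u * t) u t := by
      simpa using ((hasDerivAt_id t).const_mul u).const_add 1
    have d2 : HasDerivAt (fun t => 1 - u * t) (-u) t := by
      simpa using ((hasDerivAt_id t).const_mul u).const_sub 1
    have d3 := ((d1.log h1.ne').sub (d2.log h2.ne')).div_const (2 * u)
    refine d3.congr_deriv ?_
    have h1' := h1.ne'
    have h2' := h2.ne'
    have hu' := hu0.ne'
    have h3 : 1 - (u * t) ^ 2 = (1 + u * t) * (1 - u * t) := by ring
    rw [h3, div_eq_div_iff (mul_ne_zero two_ne_zero hu') (mul_ne_zero h1' h2')]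
    have e1' : u / (1 + u * t) * ((1 + u * t) * (1 - u * t)) = u * (1 - u * t) := by
      rw [← mul_assoc, div_mul_cancel₀ _ h1']
    have e2' : -u / (1 - u * t) * ((1 + u * t) * (1 - u * t)) = -u * (1 + u * t) := by
      rw [mul_comm (1 + u * t), ← mul_assoc, div_mul_cancel₀ _ h2']
    rw [sub_mul, e1', e2']
    ring
  have hint : IntervalIntegrable (fun t => 1 / (1 - (u * t) ^ 2)) volume 0 1 := by
    refine ContinuousOn.intervalIntegrable (continuousOn_const.div (by fun_prop) fun t ht => ?_)
    obtain ⟨h1, h2⟩ := hp t ht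
    have : 1 - (u * t) ^ 2 = (1 + u * t) * (1 - u * t) := by ring
    rw [this]; positivity
  rw [intervalIntegral.integral_eq_sub_of_hasDerivAt hderiv hint]
  simp

/-! ### Transcendence of `ℓ_{M,e}(κ)` at algebraic `κ ≠ 0` -/

/-- `isAlgebraic_sqrt`: auxiliary theorem of the first transcendence rung `k + k′ ≤ 1` of `RegKernelPairDegOne` (stmt-30572), lens-3 g9 §14 — see the module docstring; verbatim from the lens file. -/
theorem isAlgebraic_sqrt {x : ℝ} (hx : 0 ≤ x) (hxa : IsAlgebraic ℚ x) :
    IsAlgebraic ℚ (Real.sqrt x) :=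
  IsAlgebraic.of_pow two_pos (by rw [Real.sq_sqrt hx]; exact hxa)

/-- **`ℓ_{M,e}(κ)` is transcendental** for algebraic `κ ∈ (−1, ∞) ∖ {0}` and `e ∈ {1, 2}`: by the
recursion it is `a + b·ℓ_{r,e}(κ)` (`a, b ∈ ℚ̄`, `b ≠ 0`, `r < e`), and `ℓ_{0,1}, ℓ_{1,2}` are
`ℚ(κ)`-multiples of `log(1+κ) ≠ 0`, `ℓ_{0,2}` of `arctan √κ` resp. `log((1+u)/(1−u))`, all
transcendental by Baker (Lindemann). [Baker1975 Thm 2.1; folklore] -/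
theorem transcendental_ell {κ : ℝ} (hκ : -1 < κ) (hκ0 : κ ≠ 0) (hκa : IsAlgebraic ℚ κ) {M e : ℕ}
    (he : e = 1 ∨ e = 2) : Transcendental ℚ (ell M e κ) := by
  intro halg
  obtain ⟨a, b, ha, hb, hb0, hM⟩ := ell_affine_mod hκ hκ0 hκa M e
  have hr : IsAlgebraic ℚ (ell (M % e) e κ) := by
    have : ell (M % e) e κ = (ell M e κ - a) * b⁻¹ := by
      rw [hM]; field_simp; ring
    rw [this]
    exact (halg.sub ha).mul hb.inv
  have h1κ : 0 < 1 + κ := by linarith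
  have h1κa : IsAlgebraic ℚ (1 + κ) := isAlgebraic_one.add hκa
  -- the logarithmic conclusion used twice
  have hlog : IsAlgebraic ℚ (Real.log (1 + κ)) → False := fun hl => by
    have h0 := CircleBaker.log_eq_zero_of_isAlgebraic h1κ h1κa hl
    rw [Real.log_eq_zero] at h0
    rcases h0 with h0 | h0 | h0 <;> [exact absurd h0 h1κ.ne'; exact hκ0 (by linarith);
      exact absurd h0 (by linarith)]
  rcases he with rfl | rfl
  · rw [Nat.mod_one, ell_zero_one hκ hκ0] at hr
    refine hlog ?_
    have : Real.log (1 + κ) = Real.log (1 + κ) / κ * κ := by field_simp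
    rw [this]
    exact hr.mul hκa
  · rcases Nat.mod_two_eq_zero_or_one M with h2 | h2
    · rw [h2] at hr
      rcases lt_or_gt_of_ne hκ0 with hneg | hpos
      · rw [ell_zero_two_neg hκ hneg] at hr
        set u := Real.sqrt (-κ) with hu
        have hu0 : 0 < u := Real.sqrt_pos.2 (by linarith)
        have hu1 : u < 1 := by
          rw [hu, show (1 : ℝ) = Real.sqrt 1 by simp]
          exact Real.sqrt_lt_sqrt (by linarith) (by linarith)
        have hua : IsAlgebraic ℚ u := isAlgebraic_sqrt (by linarith) hκa.neg
        have hw : 0 < (1 + u) / (1 - u) := div_pos (by linarith) (by linarith)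
        have hwa : IsAlgebraic ℚ ((1 + u) / (1 - u)) :=
          (isAlgebraic_one.add hua).mul (isAlgebraic_one.sub hua).inv
        have hla : IsAlgebraic ℚ (Real.log ((1 + u) / (1 - u))) := by
          rw [Real.log_div (by linarith) (by linarith)]
          have : Real.log (1 + u) - Real.log (1 - u) =
              (Real.log (1 + u) - Real.log (1 - u)) / (2 * u) * (2 * u) := by
            field_simp
          rw [this]
          exact hr.mul ((isAlgebraic_nat 2).mul hua)
        have h0 := CircleBaker.log_eq_zero_of_isAlgebraic hw hwa hla
        rw [Real.log_eq_zero] at h0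
        rcases h0 with h0 | h0 | h0
        · exact absurd h0 hw.ne'
        · rw [div_eq_one_iff_eq (by linarith)] at h0
          linarith
        · linarith
      · rw [ell_zero_two_pos hpos] at hr
        set u := Real.sqrt κ with hu
        have hu0 : 0 < u := Real.sqrt_pos.2 hpos
        have hua : IsAlgebraic ℚ u := isAlgebraic_sqrt hpos.le hκa
        have haa : IsAlgebraic ℚ (Real.arctan u) := by
          have : Real.arctan u = Real.arctan u / u * u := by field_simp
          rw [this]
          exact hr.mul hua
        have h0 := CircleBaker.arctan_eq_zero_of_isAlgebraic hua haa
        have : u = 0 := Real.arctan_strictMono.injective (by rw [h0, Real.arctan_zero])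
        linarith
    · rw [h2, ell_one_two hκ hκ0] at hr
      refine hlog ?_
      have : Real.log (1 + κ) = Real.log (1 + κ) / (2 * κ) * (2 * κ) := by field_simp
      rw [this]
      exact hr.mul ((isAlgebraic_nat 2).mul hκa)

end RegularisedLogLayer

end Summit.KontsevichZagierPeriods.RootDecompRelativeModAbsolute.Rung30571

end
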